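import Mathlib
import HarnessLib
import Literature.Computability.QuantumComplexity.CubicForrelation
import Literature.Computability.Cryptography.ClassBQPReductionProofs
import Literature.Computability.QuantumComplexity.ForrelationMemValue
import Literature.Computability.QuantumComplexity.SignedForrelationGadget
import Literature.Computability.QuantumComplexity.ForrelationDirectSum
import Literature.Computability.QuantumComplexity.SignedCubicForrelation

/-!
# Crux idea `karp-pullback-unsigned-forrelation` for K2 = `SignedExactSliceIsLift` (stmt-QuantumAdvantage-14830)

Sketch of crux-ideator 2 (round 1). The lever: K2 is a CLASSICAL Karp reduction of a LANGUAGE into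
the PROMISE of Aaronson–Ambainis' UNSIGNED explicit Forrelation `kForrelationProblem`, whose
`PromiseBQP`-membership is the landed theorem `AaronsonAmbainis2018_kForrelation_mem_holds`; the
closure `mem_PromiseBQP_of_polyTimeReducible` (landed) then produces the separating BQP language.
Isolation (`NearExactIsExact`) is spent exactly once: it makes the map PROMISE-KEEPING on every string.

Proved here (rc 0 expected): the two abstract packaging lemmas and the reduction of K2 to ONE
classical statement `PromiseKeepingMap`. Stated (Props, for crux-plan): the bent-padding gadget
identity and the shape of the map.
-/

namespace Summit.QuantumAdvantage.QuantumAdvantage.Cruxes.SignedExactSliceIsLift.KarpPullbackCore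

open Literature.Computability.Complexity Literature.Computability.Cryptography
open Literature.Computability.QuantumComplexity

/-! ### Abstract packaging: promise-keeping maps -/

/-- **A promise-keeping `FP` map into a `PromiseBQP` problem pulls back a `BQP` LANGUAGE.**
If `ρ ∈ FP` sends EVERY string into `Q.yes ∪ Q.no` and `Q ∈ PromiseBQP`, then `ρ⁻¹(Q.yes) ∈ BQP`
(Karp closure of `PromiseBQP` + "a language is in BQP iff its trivial-promise problem is in PromiseBQP"). -/
theorem preimage_yes_mem_BQP {Q : PromiseProblem} (hQ : Q ∈ PromiseBQP) (hdis : Q.Disjoint)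
    {ρ : List Bool → List Bool} (hρ : ρ ∈ FP) (hkeep : ∀ x, (ρ x ∈ Q.yes ∨ ρ x ∈ Q.no)) :
    ρ ⁻¹' Q.yes ∈ BQP := by
  refine ofLanguage_mem_PromiseBQP_iff.1 (mem_PromiseBQP_of_polyTimeReducible ⟨ρ, hρ, ?_, ?_⟩ hQ)
  · intro x hx; exact hx
  · intro x hx
    rcases hkeep x with h | h
    · exact absurd h hx
    · exact h

/-- **Promise-keeping reductions give lifts**: if moreover `ρ` maps `S.yes` into `Q.yes` and `S.no`
into `Q.no`, then `S ∈ promiseLift BQP`, witnessed by the language `ρ⁻¹(Q.yes)`. -/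
theorem promiseLift_of_promiseKeeping {S Q : PromiseProblem} (hQ : Q ∈ PromiseBQP) (hdis : Q.Disjoint)
    {ρ : List Bool → List Bool} (hρ : ρ ∈ FP) (hkeep : ∀ x, (ρ x ∈ Q.yes ∨ ρ x ∈ Q.no))
    (hy : Set.MapsTo ρ S.yes Q.yes) (hn : Set.MapsTo ρ S.no Q.no) : S ∈ promiseLift BQP := by
  refine ⟨ρ ⁻¹' Q.yes, preimage_yes_mem_BQP hQ hdis hρ hkeep, fun x hx => hy hx, fun x hx hmem => ?_⟩
  exact (Set.disjoint_left.1 hdis) hmem (hn hx)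

/-- Converse direction (so the packaging loses nothing): a lifted problem has a promise-keeping
reduction into a `PromiseBQP` problem — the identity into the trivial-promise problem of the
separating language. Hence `promiseLift BQP` = "promise problems with a promise-keeping Karp map into
`PromiseBQP`". -/
theorem exists_promiseKeeping_of_promiseLift {S : PromiseProblem} (h : S ∈ promiseLift BQP)
    (hid : (id : List Bool → List Bool) ∈ FP) :
    ∃ Q ∈ PromiseBQP, ∃ ρ ∈ FP, (∀ x, (ρ x ∈ Q.yes ∨ ρ x ∈ Q.no)) ∧
      Set.MapsTo ρ S.yes Q.yes ∧ Set.MapsTo ρ S.no Q.no := by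
  obtain ⟨L, hL, hy, hn⟩ := h
  refine ⟨PromiseProblem.ofLanguage L, ofLanguage_mem_PromiseBQP_iff.2 hL, id, hid, fun x => ?_,
    fun x hx => hy hx, fun x hx => hn hx⟩
  by_cases hx : x ∈ L
  · exact Or.inl hx
  · exact Or.inr hx

/-! ### The one classical statement K2 reduces to -/

/-- The signed exact cubic slice (r3's promise problem; the K2 conclusion is about it). -/
abbrev slice : PromiseProblem := signedExactCubicForrelationProblem 2

/-- **THE STUB (classical).** For every isolation constant `θ < 1` there is a polynomial-time map
`ρ` sending EVERY string to a code of an explicit 2-fold Forrelation instance that is either a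
yes-instance (`Φ ≥ 3/5`) or a no-instance (`|Φ| ≤ 1/100`) of Aaronson–Ambainis' problem, exact
pairs (`Φ = 1`) to yes-instances and anti-exact pairs (`Φ = -1`) to no-instances.
Intended witness: `ρ_t(x) = encode( t-fold direct sum of the bent-padded pair P(proj₃ C₀, proj₃ C₁) )`
with `n` capped at `min(n, #read wires + 1)` and even-ised, `t = ⌈log 100 / log (2/(1+θ))⌉`:
its value is `((1 + Φ(a*,b*))/2)^t ∈ {1} ∪ [0, 1/100]` by isolation. -/
def PromiseKeepingMap : Prop :=
  ∀ θ : ℝ, θ < 1 →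
    (∀ n : ℕ, Even n → ∀ f g : (Fin n → Bool) → Bool, IsDegLeFun 3 f → IsDegLeFun 3 g →
      θ < forrelation f g → forrelation f g = 1) →
    ∃ ρ ∈ FP, (∀ x, (ρ x ∈ kForrelationProblem.yes ∨ ρ x ∈ kForrelationProblem.no)) ∧
      Set.MapsTo ρ slice.yes kForrelationProblem.yes ∧ Set.MapsTo ρ slice.no kForrelationProblem.no

/-- Local verbatim copy of the route decl `NearExactIsExact` (this Core file does not import the route
module; the by-name version `signedExactSliceIsLift_of : PromiseKeepingMap → SignedExactSliceIsLift` is in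
SketchIdeator2KarpPullback.lean, attached as evidence on stmt-QuantumAdvantage-14830, rc 0). -/
def NearExactIsExact' : Prop :=
  ∃ θ : ℝ, θ < 1 ∧ ∀ n : ℕ, Even n → ∀ f g : (Fin n → Bool) → Bool, IsDegLeFun 3 f → IsDegLeFun 3 g →
    θ < forrelation f g → forrelation f g = 1

/-- Local verbatim copy of the route decl `SignedExactSliceIsLift` (= K2), over `signedExactCubicForrelationProblem 2`
(equal to the route's inline promise problem by `signedExactCubicForrelationProblem_two_eq`, rfl). -/
def SignedExactSliceIsLift' : Prop :=
  NearExactIsExact' → signedExactCubicForrelationProblem 2 ∈ promiseLift BQP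

/-- **K2 (local copy) from the classical stub.** -/
theorem signedExactSliceIsLift'_of (h : PromiseKeepingMap) : SignedExactSliceIsLift' := by
  intro hr2
  obtain ⟨θ, hθ, hiso⟩ := hr2
  obtain ⟨ρ, hρ, hkeep, hy, hn⟩ := h θ hθ hiso
  exact promiseLift_of_promiseKeeping AaronsonAmbainis2018_kForrelation_mem_holds
    kForrelationProblem_disjoint hρ hkeep hy hn

/-! ### The bent-padding gadget (sign ↦ magnitude at the instance level) — PROVED -/

open Finset
open Literature.Computability.QuantumComplexity.DerivativeWalsh
open Literature.Computability.QuantumComplexity.SgnForrMem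

variable {n : ℕ}

/-- `F(x,c₁,c₂) = (1 ⊕ c₁)·f(x) ⊕ c₁·(c₂ ⊕ k(x))` on `{0,1}^{n+2}` (coordinates `n`, `n+1` are the pads). -/
def padF (f k : (Fin n → Bool) → Bool) (X : Fin (n + 2) → Bool) : Bool :=
  xor (!(Fin.init X (Fin.last n)) && f (Fin.init (Fin.init X)))
    ((Fin.init X (Fin.last n)) && xor (X (Fin.last (n + 1))) (k (Fin.init (Fin.init X))))

/-- `G(y,d₁,d₂) = (1 ⊕ d₂)·g(y) ⊕ d₂·(k(y) ⊕ d₁)`. -/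
def padG (g k : (Fin n → Bool) → Bool) (Y : Fin (n + 2) → Bool) : Bool :=
  xor (!(Y (Fin.last (n + 1))) && g (Fin.init (Fin.init Y)))
    ((Y (Fin.last (n + 1))) && xor (k (Fin.init (Fin.init Y))) (Fin.init Y (Fin.last n)))

@[simp] theorem padF_snoc (f k : (Fin n → Bool) → Bool) (x : Fin n → Bool) (c₁ c₂ : Bool) :
    padF f k (Fin.snoc (Fin.snoc x c₁) c₂) = xor (!c₁ && f x) (c₁ && xor c₂ (k x)) := by
  simp [padF, Fin.init_snoc, Fin.snoc_last]

@[simp] theorem padG_snoc (g k : (Fin n → Bool) → Bool) (y : Fin n → Bool) (d₁ d₂ : Bool) :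
    padG g k (Fin.snoc (Fin.snoc y d₁) d₂) = xor (!d₂ && g y) (d₂ && xor (k y) d₁) := by
  simp [padG, Fin.init_snoc, Fin.snoc_last]

/-- The Walsh transform of the padded `F`: `W_F(y,d₁,0) = 2 W_f(y)`, `W_F(y,d₁,1) = 2 (-1)^{d₁} W_k(y)`. -/
theorem W_padF (f k : (Fin n → Bool) → Bool) (y : Fin n → Bool) (d₁ d₂ : Bool) :
    W (fun X => signOf (padF f k X)) (Fin.snoc (Fin.snoc y d₁) d₂) =
      if d₂ then 2 * signOf d₁ * W (fun x => signOf (k x)) y else 2 * W (fun x => signOf (f x)) y := by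
  unfold W
  rw [sum_snoc, sum_snoc]
  simp only [padF_snoc, twist_snoc, Fintype.sum_bool, Bool.not_true, Bool.not_false, Bool.true_and,
    Bool.false_and, Bool.and_true, Bool.and_false, Bool.xor_false, Bool.false_xor, Bool.true_xor,
    signOf_xor, mul_sum, ← sum_add_distrib]
  cases d₁ <;> cases d₂ <;> simp only [signOf_true, signOf_false, if_true, if_false, Bool.false_eq_true]
    <;> refine sum_congr rfl fun x _ => ?_ <;> cases f x <;> cases k x <;> simp [signOf] <;> ring

/-- The unnormalised padded forrelation sum: `∑_Y (-1)^{G(Y)} W_F(Y) = 4 ∑_y (-1)^{g y} W_f(y) + 4·2^n·√(2^n)`. -/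
theorem sum_padded (f g k : (Fin n → Bool) → Bool) (hk : IsSelfDualBent k) :
    ∑ Y, signOf (padG g k Y) * W (fun X => signOf (padF f k X)) Y =
      4 * ∑ y, signOf (g y) * W (fun x => signOf (f x)) y + 4 * Real.sqrt (2 ^ n) * 2 ^ n := by
  have hW : ∀ y, W (fun x => signOf (k x)) y = Real.sqrt (2 ^ n) * signOf (k y) := hk
  rw [sum_snoc, sum_snoc]
  simp only [padG_snoc, W_padF, Fintype.sum_bool, Bool.not_true, Bool.not_false, Bool.true_and,
    Bool.false_and, if_true, if_false, Bool.false_eq_true, signOf_xor, signOf_true, signOf_false, hW]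
  have hcard : (4 : ℝ) * Real.sqrt (2 ^ n) * 2 ^ n = ∑ _y : Fin n → Bool, 4 * Real.sqrt (2 ^ n) := by
    simp; ring
  rw [hcard, mul_sum, ← sum_add_distrib]
  refine sum_congr rfl fun y _ => ?_
  cases k y <;> cases g y <;> simp [signOf] <;> ring

/-- **The gadget identity**: for a self-dual bent `k`, `Φ(F, G) = (1 + Φ(f, g)) / 2`. -/
theorem forrelation_pad (f g k : (Fin n → Bool) → Bool) (hk : IsSelfDualBent k) :
    forrelation (padF f k) (padG g k) = (1 + forrelation f g) / 2 := by
  rw [forrelation_eq_sum_W, forrelation_eq_sum_W, sum_padded f g k hk]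
  have h3 : Real.sqrt ((2 : ℝ) ^ (3 * (n + 2))) = 8 * Real.sqrt (2 ^ (3 * n)) := by
    rw [show (3 * (n + 2)) = 3 * n + 6 by ring, pow_add, Real.sqrt_mul (by positivity),
      show ((2 : ℝ) ^ 6) = 8 ^ 2 by norm_num, Real.sqrt_sq (by norm_num)]
    ring
  have h1 : Real.sqrt ((2 : ℝ) ^ (3 * n)) = (2 : ℝ) ^ n * Real.sqrt (2 ^ n) := by
    rw [show (3 * n) = 2 * n + n by ring, pow_add, Real.sqrt_mul (by positivity),
      show ((2 : ℝ) ^ (2 * n)) = (2 ^ n) ^ 2 by rw [← pow_mul]; ring_nf, Real.sqrt_sq (by positivity)]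
  have hpos : (2 : ℝ) ^ n ≠ 0 := by positivity
  have hpos' : Real.sqrt ((2 : ℝ) ^ n) ≠ 0 := by positivity
  rw [h3, h1]
  field_simp
  ring

/-- With `ipHalf` (self-dual bent, landed): the concrete gadget on an even number of variables. -/
theorem forrelation_pad_ipHalf (t : ℕ) (f g : (Fin (t + t) → Bool) → Bool) :
    forrelation (padF f (ipHalf t)) (padG g (ipHalf t)) = (1 + forrelation f g) / 2 :=
  forrelation_pad f g (ipHalf t) (isSelfDualBent_ipHalf t)


/-- The identity in the form quoted by the card. -/
def GadgetIdentity : Prop :=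
  ∀ (n : ℕ) (f g k : (Fin n → Bool) → Bool), IsSelfDualBent k →
    forrelation (padF f k) (padG g k) = (1 + forrelation f g) / 2

theorem gadgetIdentity_holds : GadgetIdentity := fun _ f g k hk => forrelation_pad f g k hk

/-- Consequence used by the map: with `t` direct powers, `((1 + Φ)/2)^t` — multiplicativity is the
landed `forrelation_directSum`. Exact pairs go to value `1`, anti-exact pairs to `0`, and under
isolation at `θ` everything else to `[0, ((1+θ)/2)^t]`. The arithmetic: -/
theorem pow_padded_le {θ Φ : ℝ} {t : ℕ} (hΦ : Φ ≤ θ) (hΦ' : -1 ≤ Φ) :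
    ((1 + Φ) / 2) ^ t ≤ ((1 + θ) / 2) ^ t :=
  pow_le_pow_left₀ (by linarith) (by linarith) t

/-- There is an exponent `t` with `((1+θ)/2)^t ≤ 1/100` when `θ < 1`. -/
theorem exists_pow_le {θ : ℝ} (hθ : θ < 1) (hθ' : -1 ≤ θ) : ∃ t : ℕ, ((1 + θ) / 2) ^ t ≤ 1 / 100 := by
  have h0 : 0 ≤ (1 + θ) / 2 := by linarith
  have h1 : (1 + θ) / 2 < 1 := by linarith
  obtain ⟨t, ht⟩ := exists_pow_lt_of_lt_one (by norm_num : (0 : ℝ) < 1 / 100) h1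
  exact ⟨t, ht.le⟩

end Summit.QuantumAdvantage.QuantumAdvantage.Cruxes.SignedExactSliceIsLift.KarpPullbackCore
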